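import Summits.ResolutionOfSingularities.ResolutionOfSingularities.Theorems.HilbertSamuelEliminationSigmaMaxModificationsCorridor3WLadderSegmentsBirth
import Summits.ResolutionOfSingularities.ResolutionOfSingularities.Theorems.HilbertSamuelEliminationSigmaMaxModificationsCorridor3WLadderRecognitionNearLocusWShape
import Summits.ResolutionOfSingularities.ResolutionOfSingularities.Theorems.HilbertSamuelEliminationSigmaMaxModificationsCorridor3WLadderRecognitionNearLocusWUnit
import HarnessLib

/-!
# [OURS · L1 W4.2] THE INTERIOR BIRTH STEP OF THE UNIT, KEYED ON A POINT HYPOTHESIS `F` (the `p = 2` / `Q`-generic twin of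
# `…SegmentsBirth`): stub-2's waiting-tolerant one-step geometry `BlowupTowerNearW.dichPlus_nearLocus_succ` / `nearLocus_succ_shape`
# (CJS Lemma 6.33 / Def. 6.34) read on the partially compressed tower `Seg.unitTowerL`, transferred back to the chain
# (crux `SigmaMaxModifications` stmt-ResolutionOfSingularities-18506; conjunct `SigmaMaxModificationsCorridor3` stmt-…-19249; line `w_ladder`;
# RECOGNITION assembly, Step A, division (c′) of res-L1-w42-plan-1 RULING v3.14-24 (GD))

Pool seat res-D-pv-038 (gen 8). Helper file `--supports stmt-ResolutionOfSingularities-19249 --as helper`; kernel only, no new definition.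

This is `Seg.dichPlus_regN_birth` (res-L1-w42-stub-1, `…SegmentsBirth`) VERBATIM with the (F1) characteristic hypothesis `CharHypothesis` at `x_b`
replaced by an ARBITRARY point hypothesis `F` holding along the near loci of the localised tower `locTower b` (hypothesis `hF`), and the printed
binders `Thm314_point_locus` / `CossartJannsenSaito2020_thm_3_14` / `Thm314_nearFibre_subsingleton` replaced by the same statements keyed on `F`
(section variables `h314f`, `hPb`, `h314`, the shapes of stub-2's `BlowupTowerNearW`, res-L1-w42-stub-2). Instances: `F := CharHypothesis` (with
`BlowupTowerNear.charHypothesis_of_mem_nearLocus`) is the char row; `F := GeomDirHypothesis`, with `hF` DISCHARGED at `N = 3` from `ē(x_b) ≤ 2` by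
`BlowupTowerNearGeomDir.geomDirHypothesis_of_mem_nearLocus` and the binders `Theorem314_nearFibre_geomDir` / `isIso_residueFieldMap_of_near_of_geomDirHypothesis`
/ `Theorem314_geomDir`, is the `p = 2` / `Q`-generic row (`Seg.UnitGeometryAtQM 2 ⊤` for res-L1-w42-stub-3 / res-L1-w42-stub-4's census).

* **`Seg.dichPlus_regN_birthF`** — at the `L`-th blown-up stage `r = relIdxL b L L` of the unit based at a blown-up isolated stage `b`, GIVEN (H-emp)
  below `relIdx b L`, «`N ⊆ C`» at the kept stages of rank `≤ L`, and the curve data of `N_r` — PRODUCE at the next chain stage `r' = relIdxL b L (L+1)`: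
  either «`N_{r'}` infinite, irreducible, closed non-generic points, regular (reduced)» or «`N_{r'}` finite with closed points».

OURS bookkeeping; NOT a statement of the manuscript [Hironaka2017] nor of [CossartJannsenSaito2020]. AI-written; AI review is weaker than expert
review.

References: V. Cossart, U. Jannsen, S. Saito, LNM 2270 (2020), Lemma 6.33, Def. 6.34, Def. 6.38, Thm. 3.14, p. 104–107 [CossartJannsenSaito2020].
-/

noncomputable section

set_option linter.dupNamespace false -- namespace `…Corridor3.Moving` re-enters `…Corridor3` (module convention of the Moving files)

open CategoryTheory AlgebraicGeometry TopologicalSpace Topology IsLocalRing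
open Literature.AlgebraicGeometry.Resolution Literature.RingTheory.HilbertSamuel
open Literature.AlgebraicGeometry.CossartJannsenSaito2020
open Summit.ResolutionOfSingularities.ResolutionOfSingularities.Theorems.CampaignW42
open Summit.ResolutionOfSingularities.ResolutionOfSingularities.Theorems.SigmaMaxModificationsCorridor3.Helpers

namespace Summit.ResolutionOfSingularities.ResolutionOfSingularities.Theorems.SigmaMaxModificationsCorridor3.Moving.Seg

/-! ## §2. The birth step at an interior genuine stage, keyed on a point hypothesis `F` -/

section BirthF

variable {R : ∀ S : Scheme.{0}, CentreSeq S → Prop} {N : ℕ} {ν : ℕ → ℕ} {k : Type} [Field k]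
  {c : ℕ → MarkedStage.{0}} (hc : ∀ n, CanonicalNearStep R N ν (c n) (c (n + 1))) (hRa : OracleAdmissible R)
  (hν : ν ≠ iterPSum N Phi) (h0 : Helpers.CycleInv k N ν (c 0)) (hgen : ∀ n, ∃ m, n ≤ m ∧ (c m).IsBlownUp R N ν)
  {p : ℕ} {X : Scheme.{0}} [IsLocallyNoetherian X] {x : X} (hX : IsMaximalOrigin p N ν X x)
  (hreach : Reaches R N ν (MarkedStage.init X x) (c 0))
  (F : ∀ (X : Scheme.{0}) [IsLocallyNoetherian X], X → Prop)
  (h314f : ∀ (X X' : Scheme.{0}) [IsLocallyNoetherian X] (π : X' ⟶ X) (D : X.IdealSheafData),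
    Scheme.IsExcellent X → IdealSheafData.IsPermissible D → IsBlowup π D →
      ∀ N : ℕ, topologicalKrullDim X ≤ (N : WithBot ℕ∞) →
        ∀ x : X, x ∈ D.support → F X x →
          (Scheme.dirDim X x : WithBot ℕ∞) ≤ ringKrullDim (X.presheaf.stalk x ⧸ stalkIdeal D x) + 1 →
            {x' : X' | π.base x' = x ∧ Scheme.hsFun X' N x' = Scheme.hsFun X N x}.Subsingleton)
  (hPb : ∀ (X X' : Scheme.{0}) [IsLocallyNoetherian X] [IsLocallyNoetherian X'] (π : X' ⟶ X) (D : X.IdealSheafData),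
    Scheme.IsExcellent X → IdealSheafData.IsPermissible D → IsBlowup π D →
      ∀ N : ℕ, topologicalKrullDim ↥X ≤ (N : WithBot ℕ∞) →
        ∀ x' : X', π.base x' ∈ D.support → stalkIdeal D (π.base x') = maximalIdeal _ →
          F X (π.base x') → Scheme.dirDim X (π.base x') = 1 →
            Scheme.hsFun X' N x' = Scheme.hsFun X N (π.base x') → IsIso (π.residueFieldMap x'))
  (h314 : ∀ (X X' : Scheme.{0}) [IsLocallyNoetherian X] [IsLocallyNoetherian X'] (π : X' ⟶ X) (D : X.IdealSheafData),
    Scheme.IsExcellent X → IdealSheafData.IsPermissible D → IsBlowup π D →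
      ∀ N : ℕ, topologicalKrullDim X ≤ (N : WithBot ℕ∞) →
        ∀ x' : X', π.base x' ∈ D.support → F X (π.base x') →
          Scheme.hsFun X' N x' = Scheme.hsFun X N (π.base x') →
            ringKrullDim (X.presheaf.stalk (π.base x') ⧸ stalkIdeal D (π.base x')) <
              (Scheme.dirDim X (π.base x') : WithBot ℕ∞))

include hX hreach h314f hPb h314 in
/-- **THE BIRTH STEP (interior), keyed on a point hypothesis `F`.** See the module docstring; `F := CharHypothesis` recovers
`Seg.dichPlus_regN_birth`, `F := GeomDirHypothesis` (discharged along the near loci at `N = 3` by `ē ≤ 2`) is the `p = 2` / `Q`-generic row.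
[cite: CossartJannsenSaito2020, Lemma 6.33, Def. 6.34, Def. 6.38 (iii)–(v)] -/
theorem dichPlus_regN_birthF (h36 : CossartJannsenSaito2020_thm_3_6.{0}) (h3104 : CossartJannsenSaito2020_thm_3_10_4.{0})
    (b : ℕ) (hU : ∃ U : Set (c b).W, IsOpen U ∧ (c b).pt ∈ U ∧ U ∩ Scheme.hsStratum (c b).W N ν ⊆ {(c b).pt})
    (hF : ∀ n, ∀ y ∈ (locTower hc hRa hν h0 b).nearLocus N (basePt hc hRa hν h0 b) n,
      @F ((locTower hc hRa hν h0 b).X n) ((locTower hc hRa hν h0 b).ln n) y)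
    (hē : (c b).geomDirDim ≤ 2) (L : ℕ)
    (hempL : ∀ n, n < Seg.relIdx hgen b L → ¬ (c (b + n)).IsBlownUp R N ν → (locTower hc hRa hν h0 b).C n = ∅)
    (hNC : ∀ i, i ≤ L → (upTower hc hRa hν h0 b).nearLocus N (c b).pt (Seg.relIdxL hgen b L i) ⊆ (upTower hc hRa hν h0 b).C (Seg.relIdxL hgen b L i))
    (hinf : ((upTower hc hRa hν h0 b).nearLocus N (c b).pt (Seg.relIdxL hgen b L L)).Infinite)
    (hirr : IsIrreducible ((upTower hc hRa hν h0 b).nearLocus N (c b).pt (Seg.relIdxL hgen b L L)))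
    (hpts : ∀ y ∈ (upTower hc hRa hν h0 b).nearLocus N (c b).pt (Seg.relIdxL hgen b L L),
      ¬ IsGenericPoint y ((upTower hc hRa hν h0 b).nearLocus N (c b).pt (Seg.relIdxL hgen b L L)) →
        IsClosed ({y} : Set (c (b + Seg.relIdxL hgen b L L)).W)) :
    ((((upTower hc hRa hν h0 b).nearLocus N (c b).pt (Seg.relIdxL hgen b L (L + 1))).Infinite ∧
        IsIrreducible ((upTower hc hRa hν h0 b).nearLocus N (c b).pt (Seg.relIdxL hgen b L (L + 1))) ∧
        ∀ y ∈ (upTower hc hRa hν h0 b).nearLocus N (c b).pt (Seg.relIdxL hgen b L (L + 1)),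
          ¬ IsGenericPoint y ((upTower hc hRa hν h0 b).nearLocus N (c b).pt (Seg.relIdxL hgen b L (L + 1))) →
            IsClosed ({y} : Set (c (b + Seg.relIdxL hgen b L (L + 1))).W)) ∨
      (((upTower hc hRa hν h0 b).nearLocus N (c b).pt (Seg.relIdxL hgen b L (L + 1))).Finite ∧
        ∀ y ∈ (upTower hc hRa hν h0 b).nearLocus N (c b).pt (Seg.relIdxL hgen b L (L + 1)),
          IsClosed ({y} : Set (c (b + Seg.relIdxL hgen b L (L + 1))).W))) ∧
    (((upTower hc hRa hν h0 b).nearLocus N (c b).pt (Seg.relIdxL hgen b L (L + 1))).Infinite →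
      ∀ h : IsClosed ((upTower hc hRa hν h0 b).nearLocus N (c b).pt (Seg.relIdxL hgen b L (L + 1))),
        Scheme.IsRegular (Scheme.IdealSheafData.vanishingIdeal ⟨(upTower hc hRa hν h0 b).nearLocus N (c b).pt (Seg.relIdxL hgen b L (L + 1)), h⟩).subscheme) := by
  haveI : IsLocallyNoetherian ((upTower hc hRa hν h0 b).X 0) := (upTower hc hRa hν h0 b).ln 0
  haveI : IsLocallyNoetherian (c b).W := (c b).ln
  haveI := flat_fromSpecStalk ((upTower hc hRa hν h0 b).X 0) ((c b).pt : (upTower hc hRa hν h0 b).X 0)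
  -- the partially compressed tower and its data
  haveI hNoe : IsNoetherian ((unitTowerL hc hRa hν h0 hgen b L hempL).X 0) := by
    show IsNoetherian (Spec ((c b).W.presheaf.stalk (c b).pt)); infer_instance
  have hkey := keySetting_unitTowerL hc hRa hν h0 hgen hempL (N := N)
  have hperm := isPermissible_centreIdeal_unitTowerL hc hRa hν h0 hgen hempL (N := N)
  have hcl := isClosed_hsStratumGE_unitTowerL hc hRa hν h0 hgen hempL (N := N)
  have hx : IsClosed ({basePt hc hRa hν h0 b} : Set ((unitTowerL hc hRa hν h0 hgen b L hempL).X 0)) := isClosed_singleton_closedPoint _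
  -- the point hypothesis `F` along the near loci of the partially compressed tower (its stages ARE stages of `locTower b`)
  have hFT : ∀ i, ∀ y ∈ (unitTowerL hc hRa hν h0 hgen b L hempL).nearLocus N (basePt hc hRa hν h0 b) i,
      @F ((unitTowerL hc hRa hν h0 hgen b L hempL).X i) ((unitTowerL hc hRa hν h0 hgen b L hempL).ln i) y := fun i y hy =>
    hF (Seg.relIdxL hgen b L i) y
      (((locTower hc hRa hν h0 b).nearLocus_compress_zero (htriv_of_hEmpL hc hRa hν h0 hgen hempL) N (basePt hc hRa hν h0 b) i) ▸ hy)
  have hēT : (unitTowerL hc hRa hν h0 hgen b L hempL).geomDirDimAt 0 (basePt hc hRa hν h0 b) ≤ 2 := by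
    have : (unitTowerL hc hRa hν h0 hgen b L hempL).geomDirDimAt 0 (basePt hc hRa hν h0 b) = (c b).geomDirDim :=
      Scheme.geomDirDim_fromSpecStalk_closedPoint (c b).W (c b).pt
    rw [this]; exact hē
  -- `N ⊆ C` at the kept stages, `C_L = N_L`
  have hNCT : ∀ i, i ≤ L → (unitTowerL hc hRa hν h0 hgen b L hempL).nearLocus N (basePt hc hRa hν h0 b) i ⊆ (unitTowerL hc hRa hν h0 hgen b L hempL).C i := by
    intro i hi
    rw [nearLocus_unitTowerL, unitTowerL_C]
    exact Set.preimage_mono (hNC i hi)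
  have hCNT : (unitTowerL hc hRa hν h0 hgen b L hempL).C L = (unitTowerL hc hRa hν h0 hgen b L hempL).nearLocus N (basePt hc hRa hν h0 b) L :=
    unitTowerL_C_eq_nearLocus_of_subset hc hRa hν h0 hgen hempL hX hreach hU L (hNC L le_rfl)
  -- curve data of `C_L = ι⁻¹ N_r`
  have hCeq : (unitTowerL hc hRa hν h0 hgen b L hempL).C L =
      (locι hc hRa hν h0 b (Seg.relIdxL hgen b L L)).base ⁻¹' (upTower hc hRa hν h0 b).nearLocus N (c b).pt (Seg.relIdxL hgen b L L) := by
    rw [hCNT, nearLocus_unitTowerL]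
  have hrange : ∀ q, (upTower hc hRa hν h0 b).nearLocus N (c b).pt q ⊆ Set.range (locι hc hRa hν h0 b q).base := fun q => by
    have h := BlowupTowerNear.nearLocus_subset_range_bcι (upTower hc hRa hν h0 b)
      (((upTower hc hRa hν h0 b).X 0).fromSpecStalk ((c b).pt : (upTower hc hRa hν h0 b).X 0)) N (basePt hc hRa hν h0 b) q
    rw [show (((upTower hc hRa hν h0 b).X 0).fromSpecStalk ((c b).pt : (upTower hc hRa hν h0 b).X 0)).base (basePt hc hRa hν h0 b) = (c b).pt
      from Scheme.fromSpecStalk_closedPoint] at h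
    exact h
  have hemb : ∀ q, Topology.IsEmbedding (locι hc hRa hν h0 b q).base := fun q =>
    @Scheme.Hom.isEmbedding _ _ (locι hc hRa hν h0 b q)
      ((upTower hc hRa hν h0 b).isPreimmersion_bcι (((upTower hc hRa hν h0 b).X 0).fromSpecStalk ((c b).pt : (upTower hc hRa hν h0 b).X 0)) _)
  have hsurj : ∀ q, (locι hc hRa hν h0 b q).base '' ((locι hc hRa hν h0 b q).base ⁻¹' (upTower hc hRa hν h0 b).nearLocus N (c b).pt q) =
      (upTower hc hRa hν h0 b).nearLocus N (c b).pt q := fun q =>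
    Set.image_preimage_eq_of_subset (hrange q)
  have hirrT : IsIrreducible ((unitTowerL hc hRa hν h0 hgen b L hempL).C L) := by
    rw [hCeq]; exact isIrreducible_preimage_of_isEmbedding (hemb _) hirr (hrange _)
  have hntT : ((unitTowerL hc hRa hν h0 hgen b L hempL).C L).Nontrivial := by
    rw [hCeq]; exact (hinf.preimage (hrange _)).nontrivial
  have hptsT : ∀ y ∈ (unitTowerL hc hRa hν h0 hgen b L hempL).C L, ¬ IsGenericPoint y ((unitTowerL hc hRa hν h0 hgen b L hempL).C L) →
      IsClosed ({y} : Set ((unitTowerL hc hRa hν h0 hgen b L hempL).X L)) := by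
    rw [hCeq]
    intro s hs hng
    have hng' : ¬ IsGenericPoint ((locι hc hRa hν h0 b (Seg.relIdxL hgen b L L)).base s)
        ((upTower hc hRa hν h0 b).nearLocus N (c b).pt (Seg.relIdxL hgen b L L)) := fun h =>
      hng ((isGenericPoint_iff_of_isEmbedding (hemb _) (isClosed_nearLocus hc hRa hν h0 hX hreach b _) (hsurj _) hs).mpr h)
    have hclosed := hpts _ hs hng'
    have : ({s} : Set ((unitTowerL hc hRa hν h0 hgen b L hempL).X L)) =
        (locι hc hRa hν h0 b (Seg.relIdxL hgen b L L)).base ⁻¹' {(locι hc hRa hν h0 b (Seg.relIdxL hgen b L L)).base s} := by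
      rw [← Set.image_singleton]; exact ((hemb (Seg.relIdxL hgen b L L)).injective.preimage_image {s}).symm
    rw [this]
    exact hclosed.preimage (locι hc hRa hν h0 b _).continuous
  have hη := hirrT.isGenericPoint_genericPoint ((unitTowerL hc hRa hν h0 hgen b L hempL).isClosed_C L)
  -- stub-2's waiting-tolerant one-step lemmas keyed on `F`, on the partially compressed tower
  have hshape := BlowupTowerNearW.nearLocus_succ_shape F h314f h36 h3104 hkey hperm hcl hx hFT hēT (hNCT L le_rfl) hCNT.le hirrT hntT hptsT hη
  have hplus := BlowupTowerNearW.dichPlus_nearLocus_succ F h314f hPb h314 h36 h3104 hkey hperm hcl hx hFT hēT (hNCT L le_rfl) hCNT.le hirrT hntT hptsT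
  -- the next stage of the partially compressed tower is the localised chain stage `r'`
  have hNeq : (unitTowerL hc hRa hν h0 hgen b L hempL).nearLocus N (basePt hc hRa hν h0 b) (L + 1) =
      (locTower hc hRa hν h0 b).nearLocus N (basePt hc hRa hν h0 b) (Seg.relIdxL hgen b L (L + 1)) :=
    (locTower hc hRa hν h0 b).nearLocus_compress_zero (htriv_of_hEmpL hc hRa hν h0 hgen hempL) N (basePt hc hRa hν h0 b) (L + 1)
  have hNeq' : (unitTowerL hc hRa hν h0 hgen b L hempL).nearLocus N (basePt hc hRa hν h0 b) (L + 1) =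
      (locι hc hRa hν h0 b (Seg.relIdxL hgen b L (L + 1))).base ⁻¹' (upTower hc hRa hν h0 b).nearLocus N (c b).pt (Seg.relIdxL hgen b L (L + 1)) :=
    nearLocus_unitTowerL hc hRa hν h0 hgen hempL (L + 1)
  have hxb : IsClosed ({(((upTower hc hRa hν h0 b).X 0).fromSpecStalk ((c b).pt : (upTower hc hRa hν h0 b).X 0)).base (basePt hc hRa hν h0 b)} :
      Set ((upTower hc hRa hν h0 b).X 0)) := by
    rw [show (((upTower hc hRa hν h0 b).X 0).fromSpecStalk ((c b).pt : (upTower hc hRa hν h0 b).X 0)).base (basePt hc hRa hν h0 b) = (c b).pt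
      from Scheme.fromSpecStalk_closedPoint]
    exact Reaches.isClosed_pt hX.isClosed (reaches_chain hreach hc b)
  have hNcl' : IsClosed ((upTower hc hRa hν h0 b).nearLocus N (c b).pt (Seg.relIdxL hgen b L (L + 1))) :=
    isClosed_nearLocus hc hRa hν h0 hX hreach b _
  -- closed points of the localised near locus over the base map to closed points of the chain stage
  have hclUp : ∀ s ∈ (unitTowerL hc hRa hν h0 hgen b L hempL).nearLocus N (basePt hc hRa hν h0 b) (L + 1),
      IsClosed ({s} : Set ((unitTowerL hc hRa hν h0 hgen b L hempL).X (L + 1))) →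
      IsClosed ({(locι hc hRa hν h0 b (Seg.relIdxL hgen b L (L + 1))).base s} : Set (c (b + Seg.relIdxL hgen b L (L + 1))).W) := by
    intro s hs hscl
    rw [hNeq] at hs
    exact BlowupTowerNear.isClosed_singleton_bcι_of_phi_eq (upTower hc hRa hν h0 b)
      (((upTower hc hRa hν h0 b).X 0).fromSpecStalk ((c b).pt : (upTower hc hRa hν h0 b).X 0)) (basePt hc hRa hν h0 b) _ hxb hs.1 hscl
  refine ⟨?_, fun hinf' h' => ?_⟩
  · rcases hshape with ⟨hfin, hcls, -, -⟩ | ⟨himg1, -, -, hirr1, -, hpts1⟩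
    · refine Or.inr ⟨?_, fun y hy => ?_⟩
      · have hfin' : ((locι hc hRa hν h0 b (Seg.relIdxL hgen b L (L + 1))).base ⁻¹'
            (upTower hc hRa hν h0 b).nearLocus N (c b).pt (Seg.relIdxL hgen b L (L + 1))).Finite := by rw [← hNeq']; exact hfin
        have := hfin'.image (locι hc hRa hν h0 b (Seg.relIdxL hgen b L (L + 1))).base
        rwa [hsurj] at this
      · obtain ⟨s, hs, rfl⟩ := (hsurj (Seg.relIdxL hgen b L (L + 1))).symm.subset hy |> fun h => h
        have hs' : s ∈ (unitTowerL hc hRa hν h0 hgen b L hempL).nearLocus N (basePt hc hRa hν h0 b) (L + 1) := by rw [hNeq']; exact hs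
        exact hclUp s hs' (hcls s hs')
    · refine Or.inl ⟨?_, ?_, fun y hy hng => ?_⟩
      · -- infinite: `π_{L+1}` maps `N_{L+1}` ONTO the infinite `C_L`, and `ι` is injective
        have hinfC : ((unitTowerL hc hRa hν h0 hgen b L hempL).C L).Infinite := by rw [hCeq]; exact hinf.preimage (hrange _)
        have hinfT : ((unitTowerL hc hRa hν h0 hgen b L hempL).nearLocus N (basePt hc hRa hν h0 b) (L + 1)).Infinite :=
          Set.Infinite.of_image _ (himg1.symm ▸ hinfC)
        have hinfT' : ((locι hc hRa hν h0 b (Seg.relIdxL hgen b L (L + 1))).base ⁻¹'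
            (upTower hc hRa hν h0 b).nearLocus N (c b).pt (Seg.relIdxL hgen b L (L + 1))).Infinite := by rw [← hNeq']; exact hinfT
        have := hinfT'.image ((hemb (Seg.relIdxL hgen b L (L + 1))).injective.injOn)
        rwa [hsurj] at this
      · have h1 : IsIrreducible ((locι hc hRa hν h0 b (Seg.relIdxL hgen b L (L + 1))).base ⁻¹'
            (upTower hc hRa hν h0 b).nearLocus N (c b).pt (Seg.relIdxL hgen b L (L + 1))) := by rw [← hNeq']; exact hirr1
        have := h1.image _ (locι hc hRa hν h0 b _).continuous.continuousOn
        rwa [hsurj] at this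
      · obtain ⟨s, hs, rfl⟩ := (hsurj (Seg.relIdxL hgen b L (L + 1))).symm.subset hy
        have hs' : s ∈ (unitTowerL hc hRa hν h0 hgen b L hempL).nearLocus N (basePt hc hRa hν h0 b) (L + 1) := by rw [hNeq']; exact hs
        refine hclUp s hs' (hpts1 s hs' fun hgs => hng ?_)
        have hgs' : IsGenericPoint s ((locι hc hRa hν h0 b (Seg.relIdxL hgen b L (L + 1))).base ⁻¹'
            (upTower hc hRa hν h0 b).nearLocus N (c b).pt (Seg.relIdxL hgen b L (L + 1))) := by rw [← hNeq']; exact hgs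
        exact (isGenericPoint_iff_of_isEmbedding (hemb _) hNcl' (hsurj _) hs).mp hgs'
  · -- regularity of the reduced near locus at `r'`, from the dominant branch of `dichPlus_nearLocus_succ`
    have hS : IsClosed ((unitTowerL hc hRa hν h0 hgen b L hempL).nearLocus N (basePt hc hRa hν h0 b) (L + 1)) := by
      rw [hNeq']; exact hNcl'.preimage (locι hc hRa hν h0 b _).continuous
    rcases hplus with ⟨-, -, -, hreg⟩ | ⟨hfin, -⟩
    · have hregS := hreg hS
      have hS' : IsClosed ((locTower hc hRa hν h0 b).nearLocus N (basePt hc hRa hν h0 b) (Seg.relIdxL hgen b L (L + 1))) := by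
        rw [← hNeq]; exact hS
      have hregS' : Scheme.IsRegular (Scheme.IdealSheafData.vanishingIdeal
          (⟨(locTower hc hRa hν h0 b).nearLocus N (basePt hc hRa hν h0 b) (Seg.relIdxL hgen b L (L + 1)), hS'⟩ :
            Closeds ((locTower hc hRa hν h0 b).X (Seg.relIdxL hgen b L (L + 1))))).subscheme := by
        have e : (⟨(unitTowerL hc hRa hν h0 hgen b L hempL).nearLocus N (basePt hc hRa hν h0 b) (L + 1), hS⟩ :
            Closeds ((locTower hc hRa hν h0 b).X (Seg.relIdxL hgen b L (L + 1)))) =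
            ⟨(locTower hc hRa hν h0 b).nearLocus N (basePt hc hRa hν h0 b) (Seg.relIdxL hgen b L (L + 1)), hS'⟩ := Closeds.ext hNeq
        rw [← e]; exact hregS
      exact BlowupTowerNear.isRegular_nearLocus_of_localize (upTower hc hRa hν h0 b) N (c b).pt _ hS' h' hregS'
    · exfalso
      apply hinf'
      have hfin' : ((locι hc hRa hν h0 b (Seg.relIdxL hgen b L (L + 1))).base ⁻¹'
          (upTower hc hRa hν h0 b).nearLocus N (c b).pt (Seg.relIdxL hgen b L (L + 1))).Finite := by rw [← hNeq']; exact hfin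
      have := hfin'.image (locι hc hRa hν h0 b (Seg.relIdxL hgen b L (L + 1))).base
      rwa [hsurj] at this

end BirthF

end Summit.ResolutionOfSingularities.ResolutionOfSingularities.Theorems.SigmaMaxModificationsCorridor3.Moving.Seg

end
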